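import Literature.NumberTheory.LFunctions.RealZeroLOneLowerBoundExplicit
import Literature.Barriers.Parity.SiegelZeroDichotomy
import HarnessLib

/-!
# I.1 for EVERY real primitive character, part 1: the bridge `χ ↦ K` (all conductors `q`, `4m`, `8m`)
# and the ODD column — the class number of the exceptional imaginary quadratic field under a real zero,
# kernel, explicit, fact-free

Topic `Literature/NumberTheory/LFunctions` (namespace `Literature.NumberTheory.LFunctions`, sub-namespace
`SiegelZeroClassNumber` naming the topic). Everything in this file is PROVED (theorems only; no
definition, no named fact, debt 0). Cell `parity-realchar` (SIEGEL INSTRUMENT, conditionals column, topic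
I.1 «class numbers»): the GENERAL FORM of the kernel I.1 line, removing the «odd `d_K`» restriction of
`SiegelZeroClassNumberBound.lean` / `RealZeroLOneLowerBoundExplicit.lean` (and, in the companion file
`SiegelZeroClassNumberAllConductorsEven.lean`, the `-- TODO(general form): even d_K` of
`RealQuadraticSiegelZeroClassNumberRegulator.lean`).

The earlier kernel I.1 theorems are FIELD-side and only for ODD discriminants, where the Kronecker
character is the tree's Jacobi character `jacobiChar |d_K|`. Here the statements are CHARACTER-side —
the column's own currency (`IsSiegelZero χ η` is a predicate on a character `χ mod q`) — and hold for
every primitive quadratic `χ` mod `q`, whatever the shape of the conductor (`q ≡ 3 (mod 4)`, `q = 4m`,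
`q = 8m`): by the classification of real primitive characters (Montgomery–Vaughan Theorem 9.13; tree:
`PrimitiveQuadratic.apply_prime_eq_legendreSym_neg_of_odd` / `…_of_even`,
`PrimitiveQuadratic.isFundamentalDiscriminant_neg` / `…_of_even`) an ODD such `χ` is the Kronecker
character of the imaginary quadratic field `K` with `d_K = −q`, an EVEN one that of the real quadratic
field with `d_K = q`; such a field exists (`Quadratic.exists_numberField_discr_eq`) and
`ζ_K = ζ · L(·, χ)` (`Quadratic.dedekindZeta_eq_riemannZeta_mul_LSeries_of_kronecker`, even `d_K`
included — the bridge was used inline by `RealZeroEffectiveRepulsionOdd/Even.lean`; here it is stated once,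
for EVERY `K` with the given `d_K`: `dedekindZeta_eq_of_odd`, `dedekindZeta_eq_of_even`; the sign-uniform
existence-with-factorisation form is the tree's `exists_quadraticField` of `DirichletRealZeroHoffsteinWindow.lean`),
whence Dirichlet's class number formula for `χ`
(`lOne_re_eq_of_odd`: `L(1,χ) = π h_K/√q`; `lOne_re_eq_of_even`: `L(1,χ) = 2 h_K R_K/√q`; via
`Quadratic.LFunction_one_eq_of_discr_neg_of_eq`, `Quadratic.LFunction_one_eq_dedekindZeta_residue_of_eq`).
With the two kernel-explicit halves of Montgomery–Vaughan (11.10) — `L(1,χ) ≥ 0.81 (1 − β)` at a real zero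
`β ≥ 1 − 1/(10 log q)`, `q ≥ 10⁴` (`RealZeroRepulsion.lOne_ge_of_realZero_tenth`); `L(1,χ) ≤ (1 − β) log²q`
at `β ≥ 1 − 1/(40 log q)`, `q ≥ 232` (`DirichletAbel.norm_LFunction_one_le_log_sq_of_realZero`);
`≤ 55 (1 − β) log²q` on the window `1/(4 log q)` (`RealZeroRepulsion.norm_LFunction_one_le_mul_log_sq`) —
this gives, for an ODD `χ` and EVERY quadratic field `K` with `d_K = −q` (`w_K = 2` as `q > 4`):

* `classNumber_ge_of_odd` **`(0.81/π) √q (1 − β) ≤ h_K`**; `classNumber_le_of_odd`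
  **`h_K ≤ (1/π) √q log²q (1 − β)`** (window `1/40`); `classNumber_le_of_odd_quarter`
  `h_K ≤ (55/π) √q log²q (1 − β)` (window `1/4`); `classNumber_two_sided_of_odd`;
* on the column's predicate: `classNumber_bounds_of_isSiegelZero_odd`
  **`0.81 √q/(π η log q) ≤ h_K ≤ 55 √q log q/(π η)`**, `classNumber_le_of_isSiegelZero_odd_of_forty_le`
  `h_K ≤ √q log q/(π η)` (`η ≥ 40`); packaged with the existence of the field:
  `exists_field_classNumber_bounds_of_isSiegelZero_odd`.

Print comparators: Benli–Goel–Twiss–Zaman, Lemma 2.9 (character side: `0.72 ≤ L(1,χ₁)/(1−β₁) ≤ 0.18 log²q`,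
`q > 4·10⁵`); the class-number forms of Tatuzawa / Pintz 1976 IV (one exception).

LABEL (cell rule): instrument (kernel) / conditionals I.1, all conductors. WHAT THIS IS NOT: no claim that a
real zero exists; nothing here bears on parity (H5).

## References

* [MontgomeryVaughan2007] §9.3 Theorem 9.13 (real primitive characters = Kronecker symbols of fundamental
  discriminants, `χ(−1) = sign d`); §11.2 Theorem 11.4 (11.10) (both halves, kernel versions above).
* [NeukirchANT1999] Ch. VII §5 (5.11)–(5.12) (class number formula; `ζ_K = ζ · L(χ_{d_K})`).
* [BenliGoelTwissZaman2025] Lemma 2.9 (print comparator, character side).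
* [TaoTeravainen2021] Definition 1.4 (`IsSiegelZero`).
-/

noncomputable section

open Complex
open Literature.Barriers.Parity
open Literature.NumberTheory.QuadraticFields Literature.NumberTheory.QuadraticFields.Quadratic
open _root_.NumberField _root_.NumberField.Units _root_.NumberField.InfinitePlace Module

namespace Literature.NumberTheory.LFunctions

namespace SiegelZeroClassNumber

/-! ### Numerics -/

/-- `log q ≥ 9` for `q ≥ 10⁴`. [folklore] -/
private theorem nine_le_log {q : ℕ} (hq : 10 ^ 4 ≤ q) : (9 : ℝ) ≤ Real.log q := by
  have hq' : (10 : ℝ) ^ 4 ≤ q := by exact_mod_cast hq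
  rw [Real.le_log_iff_exp_le (by linarith)]
  have h1 : Real.exp 9 = Real.exp 1 ^ 9 := by rw [← Real.exp_nat_mul]; norm_num
  rw [h1]
  calc Real.exp 1 ^ 9 ≤ 2.7182818286 ^ 9 :=
        pow_le_pow_left₀ (Real.exp_pos 1).le Real.exp_one_lt_d9.le 9
    _ ≤ (10 : ℝ) ^ 4 := by norm_num
    _ ≤ q := hq'

/-! ### The bridge: a real primitive character is the Kronecker character of the quadratic field of
discriminant `χ(−1)·q`, so `ζ_K = ζ · L(χ)` and the class number formula holds for `χ` -/

variable {q : ℕ} [NeZero q] {χ : DirichletCharacter ℂ q}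
variable {K : Type*} [Field K] [NumberField K]

/-- A primitive character to a modulus `q ≥ 2` is non-trivial. [folklore] -/
private theorem ne_one_of_isPrimitive (hq : 2 ≤ q) (hprim : χ.IsPrimitive) : χ ≠ 1 := by
  rintro rfl
  rw [DirichletCharacter.isPrimitive_def, DirichletCharacter.conductor_one] at hprim
  omega

omit [NeZero q] in
/-- An odd character is non-trivial. [folklore] -/
private theorem ne_one_of_odd (hodd : χ.Odd) : χ ≠ 1 := by
  intro h1
  have h : χ (-1) = -1 := hodd
  rw [h1] at h
  have hu : IsUnit (-1 : ZMod q) := isUnit_one.neg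
  rw [MulChar.one_apply hu] at h
  norm_num at h

/-- **`ζ_K(s) = ζ(s) L(s, χ)` for an ODD real primitive `χ` mod `q` and any quadratic field `K` with
`d_K = −q`** (`Re s > 1`): `χ` has the Kronecker values `(−q/p)` at the odd primes and the Kronecker value at
`2` (tree: `PrimitiveQuadratic.apply_prime_eq_legendreSym_neg_of_odd`, `apply_two_*`), and the decomposition
law gives the Euler product (`Quadratic.dedekindZeta_eq_riemannZeta_mul_LSeries_of_kronecker`).
[cite: MontgomeryVaughan2007, §9.3 Theorem 9.13] [cite: NeukirchANT1999, Ch. VII §5 (5.12)] -/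
theorem dedekindZeta_eq_of_odd (h2 : finrank ℚ K = 2) (hdK : NumberField.discr K = -(q : ℤ))
    (hprim : χ.IsPrimitive) (hquad : χ.IsQuadratic) (hodd : χ.Odd) {s : ℂ} (hs : 1 < s.re) :
    NumberField.dedekindZeta K s = riemannZeta s * LSeries (fun n => χ n) s := by
  refine dedekindZeta_eq_riemannZeta_mul_LSeries_of_kronecker h2 χ ?_ ?_ hs
  · intro p hp hp2
    haveI := Fact.mk hp
    rw [hdK, PrimitiveQuadratic.apply_prime_eq_legendreSym_neg_of_odd hprim hquad hodd p hp2,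
      jacobiSym.legendreSym.to_jacobiSym]
  · rw [hdK]
    rcases Nat.even_or_odd q with hev | hod
    · have h8a : (-(q : ℤ)) % 8 ≠ 1 := by obtain ⟨k, hk⟩ := hev; omega
      have h8b : (-(q : ℤ)) % 8 ≠ 5 := by obtain ⟨k, hk⟩ := hev; omega
      rw [if_neg h8a, if_neg h8b, PrimitiveQuadratic.apply_two_of_even hev χ]
    · by_cases h1 : (-(q : ℤ)) % 8 = 1
      · rw [if_pos h1, PrimitiveQuadratic.apply_two_eq_one_of_odd hod hprim hquad hodd h1]
      · have h4 : q % 4 = 3 := PrimitiveQuadratic.mod_four_eq_three_of_odd hod hprim hquad hodd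
        have h5 : (-(q : ℤ)) % 8 = 5 := by omega
        rw [if_neg h1, if_pos h5, PrimitiveQuadratic.apply_two_eq_neg_one_of_odd hod hprim hquad hodd h5]

/-- **`ζ_K(s) = ζ(s) L(s, χ)` for an EVEN real primitive `χ` mod `q > 1` and any quadratic field `K` with
`d_K = q`** (`Re s > 1`). [cite: MontgomeryVaughan2007, §9.3 Theorem 9.13]
[cite: NeukirchANT1999, Ch. VII §5 (5.12)] -/
theorem dedekindZeta_eq_of_even (h2 : finrank ℚ K = 2) (hdK : NumberField.discr K = (q : ℤ))
    (hq : 1 < q) (hprim : χ.IsPrimitive) (hquad : χ.IsQuadratic) (heven : χ.Even) {s : ℂ}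
    (hs : 1 < s.re) :
    NumberField.dedekindZeta K s = riemannZeta s * LSeries (fun n => χ n) s := by
  refine dedekindZeta_eq_riemannZeta_mul_LSeries_of_kronecker h2 χ ?_ ?_ hs
  · intro p hp hp2
    haveI := Fact.mk hp
    rw [hdK, PrimitiveQuadratic.apply_prime_eq_legendreSym_of_even hprim hquad heven p hp2,
      jacobiSym.legendreSym.to_jacobiSym]
  · rw [hdK]
    rcases Nat.even_or_odd q with hev | hod
    · have h8a : (q : ℤ) % 8 ≠ 1 := by obtain ⟨k, hk⟩ := hev; omega
      have h8b : (q : ℤ) % 8 ≠ 5 := by obtain ⟨k, hk⟩ := hev; omega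
      rw [if_neg h8a, if_neg h8b, PrimitiveQuadratic.apply_two_of_even hev χ]
    · have hsq := PrimitiveQuadratic.squarefree_of_isPrimitive_of_isQuadratic hod hprim hquad
      have h4 : (q : ℤ) % 4 = 1 := by
        have := PrimitiveQuadratic.mod_four_eq_one_of_even hod hq hprim hquad heven
        omega
      have hval : χ (2 : ZMod q) = (jacobiSym 2 q : ℂ) := by
        have := PrimitiveQuadratic.apply_natCast_eq_jacobiSym hod hsq χ hprim hquad 2
        rw [Nat.cast_ofNat] at this
        rw [this]; norm_cast
      by_cases h1 : (q : ℤ) % 8 = 1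
      · have hJ : jacobiSym 2 q = 1 := by
          have := (jacobiSym_two_natAbs_eq_one_iff h4).mpr h1
          rwa [Int.natAbs_natCast] at this
        rw [if_pos h1, hval, hJ, Int.cast_one]
      · have h5 : (q : ℤ) % 8 = 5 := by omega
        have hJ : jacobiSym 2 q = -1 := by
          have := (jacobiSym_two_natAbs_eq_neg_one_iff h4).mpr h5
          rwa [Int.natAbs_natCast] at this
        rw [if_neg h1, if_pos h5, hval, hJ, Int.cast_neg, Int.cast_one]

/-- **Class number formula for an ODD real primitive `χ` mod `q > 4`:** for every quadratic field `K` with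
`d_K = −q`, `L(1, χ) = π h_K/√q` (`w_K = 2` since `d_K < −4`; tree `Quadratic.LFunction_one_eq_of_discr_neg_of_eq`,
`torsionOrder_eq_two_of_discr_lt_neg_four`). [cite: NeukirchANT1999, Ch. VII §5 (5.11)] -/
theorem lOne_re_eq_of_odd (h2 : finrank ℚ K = 2) (hdK : NumberField.discr K = -(q : ℤ)) (hq : 4 < q)
    (hprim : χ.IsPrimitive) (hquad : χ.IsQuadratic) (hodd : χ.Odd) :
    (χ.LFunction 1).re = Real.pi * classNumber K / Real.sqrt q := by
  have hq0 : 0 < q := by omega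
  have hd : NumberField.discr K < 0 := by rw [hdK, neg_lt_zero]; exact_mod_cast hq0
  have hd4 : NumberField.discr K < -4 := by
    rw [hdK]; have : (4 : ℤ) < q := by exact_mod_cast hq
    omega
  have hL := LFunction_one_eq_of_discr_neg_of_eq h2 hd (ne_one_of_odd hodd)
    (fun s hs => dedekindZeta_eq_of_odd h2 hdK hprim hquad hodd (by simpa using hs))
  have habs : |(NumberField.discr K : ℝ)| = (q : ℝ) := by
    rw [hdK]; push_cast; rw [abs_neg]; exact abs_of_nonneg (Nat.cast_nonneg q)
  rw [habs] at hL
  have hw : torsionOrder K = 2 := torsionOrder_eq_two_of_discr_lt_neg_four h2 hd4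
  have hsqrt : (0 : ℝ) < Real.sqrt q := Real.sqrt_pos.mpr (by exact_mod_cast hq0)
  rw [hL, hw, Complex.ofReal_re]
  push_cast
  field_simp

/-- The same as a norm: `‖L(1,χ)‖ = π h_K/√q` (the value is a positive real).
[cite: NeukirchANT1999, Ch. VII §5 (5.11)] -/
theorem norm_lOne_eq_of_odd (h2 : finrank ℚ K = 2) (hdK : NumberField.discr K = -(q : ℤ)) (hq : 4 < q)
    (hprim : χ.IsPrimitive) (hquad : χ.IsQuadratic) (hodd : χ.Odd) :
    ‖χ.LFunction 1‖ = Real.pi * classNumber K / Real.sqrt q := by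
  have hq0 : 0 < q := by omega
  have hd : NumberField.discr K < 0 := by rw [hdK, neg_lt_zero]; exact_mod_cast hq0
  have hL := LFunction_one_eq_of_discr_neg_of_eq h2 hd (ne_one_of_odd hodd)
    (fun s hs => dedekindZeta_eq_of_odd h2 hdK hprim hquad hodd (by simpa using hs))
  have hre := lOne_re_eq_of_odd h2 hdK hq hprim hquad hodd
  have hnn : 0 ≤ Real.pi * classNumber K / Real.sqrt q := by positivity
  rw [hL, Complex.norm_real, Real.norm_eq_abs] at *
  rw [Complex.ofReal_re] at hre
  rw [hre, abs_of_nonneg hnn]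

/-- **Class number formula for an EVEN real primitive `χ` mod `q > 1`:** for every quadratic field `K` with
`d_K = q` (real quadratic), `L(1, χ) = 2 h_K R_K/√q` (`r₁ = 2`, `r₂ = 0`, `w_K = 2`; tree
`Quadratic.LFunction_one_eq_dedekindZeta_residue_of_eq`, `torsionOrder_eq_two_of_discr_pos`).
[cite: NeukirchANT1999, Ch. VII §5 (5.11)] -/
theorem lOne_re_eq_of_even (h2 : finrank ℚ K = 2) (hdK : NumberField.discr K = (q : ℤ)) (hq : 1 < q)
    (hprim : χ.IsPrimitive) (hquad : χ.IsQuadratic) (heven : χ.Even) :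
    (χ.LFunction 1).re = 2 * classNumber K * regulator K / Real.sqrt q := by
  have hq0 : 0 < q := by omega
  have hd : 0 < NumberField.discr K := by rw [hdK]; exact_mod_cast hq0
  have hχ1 : χ ≠ 1 := ne_one_of_isPrimitive (by omega) hprim
  have hL := LFunction_one_eq_dedekindZeta_residue_of_eq hχ1
    (fun s hs => dedekindZeta_eq_of_even h2 hdK hq hprim hquad heven (by simpa using hs))
  obtain ⟨h0, h1⟩ := nrRealPlaces_eq_two_and_nrComplexPlaces_eq_zero h2 hd
  have hw : torsionOrder K = 2 := torsionOrder_eq_two_of_discr_pos h2 hd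
  have habs : |(NumberField.discr K : ℝ)| = (q : ℝ) := by
    rw [hdK]; push_cast; exact abs_of_nonneg (Nat.cast_nonneg q)
  have hsqrt : (0 : ℝ) < Real.sqrt q := Real.sqrt_pos.mpr (by exact_mod_cast hq0)
  rw [hL, NumberField.dedekindZeta_residue_def, h0, h1, hw, habs, Complex.ofReal_re]
  push_cast
  field_simp

/-- The same as a norm: `‖L(1,χ)‖ = 2 h_K R_K/√q`. [cite: NeukirchANT1999, Ch. VII §5 (5.11)] -/
theorem norm_lOne_eq_of_even (h2 : finrank ℚ K = 2) (hdK : NumberField.discr K = (q : ℤ)) (hq : 1 < q)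
    (hprim : χ.IsPrimitive) (hquad : χ.IsQuadratic) (heven : χ.Even) :
    ‖χ.LFunction 1‖ = 2 * classNumber K * regulator K / Real.sqrt q := by
  have hχ1 : χ ≠ 1 := ne_one_of_isPrimitive (by omega) hprim
  have hL := LFunction_one_eq_dedekindZeta_residue_of_eq hχ1
    (fun s hs => dedekindZeta_eq_of_even h2 hdK hq hprim hquad heven (by simpa using hs))
  have hre := lOne_re_eq_of_even h2 hdK hq hprim hquad heven
  have hnn : 0 ≤ 2 * classNumber K * regulator K / Real.sqrt q := by
    have := regulator_pos K
    positivity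
  rw [hL, Complex.norm_real, Real.norm_eq_abs] at *
  rw [Complex.ofReal_re] at hre
  rw [hre, abs_of_nonneg hnn]

/-- **The exceptional field exists (odd case):** for an odd real primitive `χ` mod `q`, `−q` is a fundamental
discriminant, so there is a quadratic field with `d_K = −q` (tree `Quadratic.exists_numberField_discr_eq` on
`PrimitiveQuadratic.isFundamentalDiscriminant_neg`). [cite: MontgomeryVaughan2007, §9.3 Theorem 9.13] -/
theorem exists_field_of_odd (hprim : χ.IsPrimitive) (hquad : χ.IsQuadratic) (hodd : χ.Odd) :
    ∃ (K : Type) (_ : Field K) (_ : NumberField K), finrank ℚ K = 2 ∧ NumberField.discr K = -(q : ℤ) :=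
  exists_numberField_discr_eq (PrimitiveQuadratic.isFundamentalDiscriminant_neg hprim hquad hodd)

/-- **The exceptional field exists (even case):** for an even real primitive `χ` mod `q > 1` there is a (real)
quadratic field with `d_K = q`. [cite: MontgomeryVaughan2007, §9.3 Theorem 9.13] -/
theorem exists_field_of_even (hq : 1 < q) (hprim : χ.IsPrimitive) (hquad : χ.IsQuadratic)
    (heven : χ.Even) :
    ∃ (K : Type) (_ : Field K) (_ : NumberField K), finrank ℚ K = 2 ∧ NumberField.discr K = (q : ℤ) :=
  exists_numberField_discr_eq (PrimitiveQuadratic.isFundamentalDiscriminant_of_even hprim hquad heven hq)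

/-! ### ODD characters: the class number of the imaginary quadratic field `d_K = −q` -/

/-- **`h_K ≥ (0.81/π) √q (1 − β)` (kernel, fact-free; all odd conductors).** For an odd primitive quadratic
`χ` mod `q ≥ 10⁴`, a real zero `β ≥ 1 − 1/(10 log q)` of `L(s,χ)`, and any quadratic field `K` with
`d_K = −q`: `L(1,χ) = π h_K/√q ≥ 0.81 (1 − β)`. Print comparator `0.36/π · w_K √q (1−β₁) ≤ h_K`
(`q > 4·10⁵`, Benli–Goel–Twiss–Zaman Lemma 2.9 via the class number formula).
[cite: MontgomeryVaughan2007, §11.2 (11.10)] [cite: BenliGoelTwissZaman2025, Lemma 2.9]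
[cite: NeukirchANT1999, Ch. VII §5 (5.11)] -/
theorem classNumber_ge_of_odd (h2 : finrank ℚ K = 2) (hdK : NumberField.discr K = -(q : ℤ))
    (hq : 10 ^ 4 ≤ q) (hprim : χ.IsPrimitive) (hquad : χ.IsQuadratic) (hodd : χ.Odd) {β : ℝ}
    (hβ : 1 - 1 / (10 * Real.log q) ≤ β) (hz : χ.LFunction β = 0) :
    0.81 / Real.pi * Real.sqrt q * (1 - β) ≤ (classNumber K : ℝ) := by
  have hlow := RealZeroRepulsion.lOne_ge_of_realZero_tenth χ hq hprim hquad hz hβ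
  rw [lOne_re_eq_of_odd h2 hdK (by omega) hprim hquad hodd] at hlow
  have hsqrt : (0 : ℝ) < Real.sqrt q := Real.sqrt_pos.mpr (by exact_mod_cast (show 0 < q by omega))
  rw [le_div_iff₀ hsqrt] at hlow
  have hpi := Real.pi_pos
  rw [show 0.81 / Real.pi * Real.sqrt q * (1 - β) = 0.81 * (1 - β) * Real.sqrt q / Real.pi by ring,
    div_le_iff₀ hpi]
  linarith

/-- **`h_K ≤ (1/π) √q log²q (1 − β)` (kernel; window `1/(40 log q)`, `q ≥ 232`; all odd conductors).**
[cite: MontgomeryVaughan2007, §11.2 (11.10)] [cite: NeukirchANT1999, Ch. VII §5 (5.11)] -/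
theorem classNumber_le_of_odd (h2 : finrank ℚ K = 2) (hdK : NumberField.discr K = -(q : ℤ))
    (hq : 232 ≤ q) (hprim : χ.IsPrimitive) (hquad : χ.IsQuadratic) (hodd : χ.Odd) {β : ℝ}
    (hβ : 1 - 1 / (40 * Real.log q) ≤ β) (hz : χ.LFunction β = 0) :
    (classNumber K : ℝ) ≤ 1 / Real.pi * Real.sqrt q * Real.log q ^ 2 * (1 - β) := by
  have hup := DirichletAbel.norm_LFunction_one_le_log_sq_of_realZero hq hprim hβ hz
  rw [norm_lOne_eq_of_odd h2 hdK (by omega) hprim hquad hodd] at hup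
  have hsqrt : (0 : ℝ) < Real.sqrt q := Real.sqrt_pos.mpr (by exact_mod_cast (show 0 < q by omega))
  rw [div_le_iff₀ hsqrt] at hup
  have hpi := Real.pi_pos
  rw [show 1 / Real.pi * Real.sqrt q * Real.log q ^ 2 * (1 - β) =
      (1 - β) * Real.log q ^ 2 * Real.sqrt q / Real.pi by ring, le_div_iff₀ hpi]
  linarith

/-- **`h_K ≤ (55/π) √q log²q (1 − β)` on the wider window `1/(4 log q)` (`q ≥ 8`; all odd conductors).**
[cite: MontgomeryVaughan2007, §11.2 (11.10)] [cite: NeukirchANT1999, Ch. VII §5 (5.11)] -/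
theorem classNumber_le_of_odd_quarter (h2 : finrank ℚ K = 2) (hdK : NumberField.discr K = -(q : ℤ))
    (hq : 8 ≤ q) (hprim : χ.IsPrimitive) (hquad : χ.IsQuadratic) (hodd : χ.Odd) {β : ℝ}
    (hβ : 1 - 1 / (4 * Real.log q) ≤ β) (hz : χ.LFunction β = 0) :
    (classNumber K : ℝ) ≤ 55 / Real.pi * Real.sqrt q * Real.log q ^ 2 * (1 - β) := by
  have hup := RealZeroRepulsion.norm_LFunction_one_le_mul_log_sq hq χ (ne_one_of_odd hodd) hβ hz
  rw [norm_lOne_eq_of_odd h2 hdK (by omega) hprim hquad hodd] at hup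
  have hsqrt : (0 : ℝ) < Real.sqrt q := Real.sqrt_pos.mpr (by exact_mod_cast (show 0 < q by omega))
  rw [div_le_iff₀ hsqrt] at hup
  have hpi := Real.pi_pos
  rw [show 55 / Real.pi * Real.sqrt q * Real.log q ^ 2 * (1 - β) =
      55 * (1 - β) * Real.log q ^ 2 * Real.sqrt q / Real.pi by ring, le_div_iff₀ hpi]
  linarith

/-- **Two-sided, kernel (odd conductors):** `q ≥ 10⁴`, real zero `β ≥ 1 − 1/(40 log q)`:
`(0.81/π) √q (1−β) ≤ h_K ≤ (1/π) √q log²q (1−β)` for every quadratic `K` with `d_K = −q`.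
[cite: MontgomeryVaughan2007, §11.2 (11.10)] [cite: NeukirchANT1999, Ch. VII §5 (5.11)] -/
theorem classNumber_two_sided_of_odd (h2 : finrank ℚ K = 2) (hdK : NumberField.discr K = -(q : ℤ))
    (hq : 10 ^ 4 ≤ q) (hprim : χ.IsPrimitive) (hquad : χ.IsQuadratic) (hodd : χ.Odd) {β : ℝ}
    (hβ : 1 - 1 / (40 * Real.log q) ≤ β) (hz : χ.LFunction β = 0) :
    0.81 / Real.pi * Real.sqrt q * (1 - β) ≤ (classNumber K : ℝ) ∧
      (classNumber K : ℝ) ≤ 1 / Real.pi * Real.sqrt q * Real.log q ^ 2 * (1 - β) := by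
  have hL9 := nine_le_log hq
  have hβ10 : 1 - 1 / (10 * Real.log q) ≤ β := by
    have : 1 / (40 * Real.log q) ≤ 1 / (10 * Real.log q) :=
      one_div_le_one_div_of_le (by positivity) (by linarith)
    linarith
  exact ⟨classNumber_ge_of_odd h2 hdK hq hprim hquad hodd hβ10 hz,
    classNumber_le_of_odd h2 hdK (le_trans (by norm_num) hq) hprim hquad hodd hβ hz⟩

/-- **The class number of the exceptional imaginary quadratic field under a Siegel zero of quality `η`
(kernel, all odd conductors).** If an odd `χ` mod `q ≥ 10⁴` carries a Tao–Teräväinen Siegel zero of quality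
`η` (`χ` primitive quadratic, `η ≥ 10`, `L(1 − 1/(η log q), χ) = 0`), then for every quadratic field `K` with
`d_K = −q`: **`0.81 √q/(π η log q) ≤ h_K ≤ 55 √q log q/(π η)`**. [cite: TaoTeravainen2021, Definition 1.4]
[cite: MontgomeryVaughan2007, §11.2 (11.10)] [cite: NeukirchANT1999, Ch. VII §5 (5.11)] -/
theorem classNumber_bounds_of_isSiegelZero_odd (h2 : finrank ℚ K = 2)
    (hdK : NumberField.discr K = -(q : ℤ)) (hq : 10 ^ 4 ≤ q) {η : ℝ} (hS : IsSiegelZero χ η)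
    (hodd : χ.Odd) :
    0.81 / Real.pi * Real.sqrt q / (η * Real.log q) ≤ (classNumber K : ℝ) ∧
      (classNumber K : ℝ) ≤ 55 / Real.pi * Real.sqrt q * Real.log q / η := by
  obtain ⟨hprim, hquad, h10, hzero⟩ := hS
  have hL9 := nine_le_log hq
  have hL0 : 0 < Real.log q := by linarith
  have hη0 : 0 < η := by linarith
  set β : ℝ := 1 - 1 / (η * Real.log q) with hβdef
  have hκ : 1 - β = 1 / (η * Real.log q) := by rw [hβdef]; ring
  have hβ10 : 1 - 1 / (10 * Real.log q) ≤ β := by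
    have : 1 / (η * Real.log q) ≤ 1 / (10 * Real.log q) :=
      one_div_le_one_div_of_le (by positivity) (mul_le_mul_of_nonneg_right h10 hL0.le)
    rw [hβdef]; linarith
  have hβ4 : 1 - 1 / (4 * Real.log q) ≤ β := by
    have : 1 / (10 * Real.log q) ≤ 1 / (4 * Real.log q) :=
      one_div_le_one_div_of_le (by positivity) (by linarith)
    linarith
  have hlow := classNumber_ge_of_odd h2 hdK hq hprim hquad hodd hβ10 hzero
  have hup := classNumber_le_of_odd_quarter h2 hdK (le_trans (by norm_num) hq) hprim hquad hodd hβ4 hzero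
  rw [hκ] at hlow hup
  constructor
  · calc 0.81 / Real.pi * Real.sqrt q / (η * Real.log q)
        = 0.81 / Real.pi * Real.sqrt q * (1 / (η * Real.log q)) := by ring
      _ ≤ (classNumber K : ℝ) := hlow
  · calc (classNumber K : ℝ)
        ≤ 55 / Real.pi * Real.sqrt q * Real.log q ^ 2 * (1 / (η * Real.log q)) := hup
      _ = 55 / Real.pi * Real.sqrt q * Real.log q / η := by field_simp

/-- **Quality `η ≥ 40` (window `1/40`): `h_K ≤ √q log q/(π η)`** (odd conductors).
[cite: TaoTeravainen2021, Definition 1.4] [cite: MontgomeryVaughan2007, §11.2 (11.10)] -/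
theorem classNumber_le_of_isSiegelZero_odd_of_forty_le (h2 : finrank ℚ K = 2)
    (hdK : NumberField.discr K = -(q : ℤ)) (hq : 10 ^ 4 ≤ q) {η : ℝ} (hS : IsSiegelZero χ η)
    (hodd : χ.Odd) (h40 : 40 ≤ η) :
    (classNumber K : ℝ) ≤ 1 / Real.pi * Real.sqrt q * Real.log q / η := by
  obtain ⟨hprim, hquad, -, hzero⟩ := hS
  have hL9 := nine_le_log hq
  have hL0 : 0 < Real.log q := by linarith
  have hη0 : 0 < η := by linarith
  set β : ℝ := 1 - 1 / (η * Real.log q) with hβdef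
  have hκ : 1 - β = 1 / (η * Real.log q) := by rw [hβdef]; ring
  have hβ40 : 1 - 1 / (40 * Real.log q) ≤ β := by
    have : 1 / (η * Real.log q) ≤ 1 / (40 * Real.log q) :=
      one_div_le_one_div_of_le (by positivity) (mul_le_mul_of_nonneg_right h40 hL0.le)
    rw [hβdef]; linarith
  have hup := classNumber_le_of_odd h2 hdK (le_trans (by norm_num) hq) hprim hquad hodd hβ40 hzero
  rw [hκ] at hup
  calc (classNumber K : ℝ)
      ≤ 1 / Real.pi * Real.sqrt q * Real.log q ^ 2 * (1 / (η * Real.log q)) := hup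
    _ = 1 / Real.pi * Real.sqrt q * Real.log q / η := by field_simp

/-- **Packaged form (odd):** under a Siegel zero of quality `η` at an odd `χ` mod `q ≥ 10⁴`, the exceptional
imaginary quadratic field EXISTS and its class number is pinned:
`∃ K, [K:ℚ] = 2, d_K = −q, 0.81 √q/(π η log q) ≤ h_K ≤ 55 √q log q/(π η)`.
[cite: TaoTeravainen2021, Definition 1.4] [cite: MontgomeryVaughan2007, §9.3 Theorem 9.13; §11.2 (11.10)] -/
theorem exists_field_classNumber_bounds_of_isSiegelZero_odd (hq : 10 ^ 4 ≤ q) {η : ℝ}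
    (hS : IsSiegelZero χ η) (hodd : χ.Odd) :
    ∃ (K : Type) (_ : Field K) (_ : NumberField K), finrank ℚ K = 2 ∧
      NumberField.discr K = -(q : ℤ) ∧
      0.81 / Real.pi * Real.sqrt q / (η * Real.log q) ≤ (classNumber K : ℝ) ∧
      (classNumber K : ℝ) ≤ 55 / Real.pi * Real.sqrt q * Real.log q / η := by
  obtain ⟨K, hF, hNF, h2, hdK⟩ := exists_field_of_odd hS.1 hS.2.1 hodd
  exact ⟨K, hF, hNF, h2, hdK, classNumber_bounds_of_isSiegelZero_odd h2 hdK hq hS hodd⟩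

end SiegelZeroClassNumber

end Literature.NumberTheory.LFunctions

end
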